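import Summits.NavierStokesRegularity.FluidComputer.ClayBlowupProfileEnergy
import Summits.NavierStokesRegularity.FluidComputer.ClayBlowupZoomTools
import Summits.NavierStokesRegularity.FluidComputer.ClayBlowupOfBreakdown
import Literature.Analysis.FluidPDE.OseenDuhamelLocalEnergyTail
import Literature.Analysis.FluidPDE.ForcedOseenRepresentationPointwise
import HarnessLib

/-!
# THE BLOW-UP PROFILE OF A CLAY BLOW-UP WITH ITS CLAY FORCE: off the compact `ℋ¹`-null singular
# slice the velocity converges, as `t ↑ T`, to a CONTINUOUS finite-energy profile `u(T, ·)`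

Cell `ns-blowup`, seat `ns-blowup-ecbridge-2` (g11; the E–C endpoint theory seat). LABEL: E–C typing
(KERNEL — no named fact, no new definition). WHAT THIS IS NOT: not Navier–Stokes evidence — a
structural necessary condition on the inhabitants of the TYPE `ClayBlowup ν` (Fefferman's (C)
certificates by blow-up, WITH their force); no inhabitant is claimed. Companion memo:
`run/shared/lean/pub/ns-blowup/ecbridge2/ECBRIDGE-2-MEMO-10.md`.

## Content

g8's `ClayBlowup.exists_blowupProfile` (`ClayBlowupProfile.lean`) is the row «the final state of a
¬(A) witness is a field continuous off `S_T`», for the UNFORCED inhabitants only (`hf : X.f = 0`): it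
runs Escauriaza–Seregin–Šverák's Thm. 1.4 at the top of a backward cylinder, which the tree holds
without force. This file removes `hf` WITHOUT a forced local regularity theorem, through the forced
Oseen representation from a fixed base time `s < T` (`eq_forced_oseenMild_of_bounded`, every point):
`u(t) = e^{ν(t−s)Δ}u(s) − B^ν_s(u,u)(t) + ∫ₛᵗ e^{ν(t−τ)Δ} P f`. Near a backward-bounded point `x₀`
the caloric term and the force term are continuous up to `T` (`continuous_uncurry_forceDuhamel`),
and so is the Duhamel term: its only unbounded inputs sit outside `B(x₀, r)` at late times, where the
kernel seen from `B(x₀, r/2)` is bounded and the inputs are paid by the ENERGY of the type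
(`exists_continuousOn_oseenDuhamel_top`: `B^ν_s(u,u)` is a uniform limit of Duhamel terms of bounded
truncations, continuous on the closed slab by KNSS's (3.10)).

* `ClayBlowup.exists_continuousOn_closure_cylinder_forced` — at a backward bounded point `x₀` of a
  Clay blow-up WITH force (`ν > 0`) there are `r > 0` (`r² ≤ T`) and `W` continuous on
  `closure Q_r(T, x₀)` with `u = W` on `Q_r(T, x₀)`;
* `ClayBlowup.exists_blowupProfile_forced`, `tendsto_slice_blowupProfile_forced` — a profile `U`,
  continuous on the regular set `ℝ³ ∖ S_T`, with `u(t, y) → U(x)` as `(t, y) → (T, x)` from below at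
  every regular `x`;
* `ClayBlowup.exists_blowupProfile_finiteEnergy_forced` — `u(t) → U` a.e. and `∫ |U|² ≤ E`;
* `DesignedBlowup` twins and the (C)-reading `navierStokesBreakdownR3_profile`.

With g6/g7 (`singularSlice_compact_nonempty_hausdorffOne_null`, force-free) the structure row of the
census reads, now WITH THE CLAY FORCE: the final state of a (C)-certificate by blow-up is a
finite-energy field, continuous off a nonempty compact `ℋ¹`-null set, attained locally uniformly.

References: J. Leray, Acta Math. 63 (1934), §32 [cite: Leray1934, §32]; P. G. Lemarié-Rieusset,
*The Navier–Stokes Problem in the 21st Century* (2016), Thm. 6.1 [cite: LemarieRieusset2016, Thm. 6.1];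
G. Koch, N. Nadirashvili, G. Seregin, V. Šverák, Acta Math. 203 (2009), §3 (3.10), §4
[cite: KochNadirashviliSereginSverak2009, §3 (3.10)]; C. L. Fefferman, Clay problem description, (C)
[cite: FeffermanClay2006, (C)].
-/

noncomputable section

namespace Summit.NavierStokesRegularity.FluidComputer

open Set MeasureTheory Filter Topology Function Metric TopologicalSpace
open scoped ENNReal NNReal
open Literature.Analysis Literature.Analysis.FluidPDE
open Summit.NavierStokesRegularity.NavierStokesRegularity

namespace ClayBlowup

variable {ν : ℝ} (X : ClayBlowup ν)

/-! ## §1 A continuous representative up to the top at every regular point, WITH the force -/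

/-- **At a backward bounded point a Clay blow-up WITH ITS CLAY FORCE is continuous up to the blow-up
time** (`ν > 0`; no named fact): there are `r > 0` with `r² ≤ T` and `W : ℝ × ℝ³ → ℝ³` continuous on
`closure Q_r(T, x₀)` with `u(t, y) = W(t, y)` on `Q_r(T, x₀)`. `W` is the caloric term plus the force
term minus the continuous extension of the Duhamel term of the forced Oseen representation from the
base time `T − ρ²/2`. [cite: LemarieRieusset2016, Thm. 6.1 (6.12)]
[cite: KochNadirashviliSereginSverak2009, §3 (3.10) and §4 p. 8 (arXiv:0709.3599)] -/
theorem exists_continuousOn_closure_cylinder_forced (hν : 0 < ν)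
    {x₀ : EuclideanSpace ℝ (Fin 3)} (hx₀ : IsBackwardBoundedAt X.u X.T x₀) :
    ∃ r : ℝ, 0 < r ∧ r ^ 2 ≤ X.T ∧ ∃ W : ℝ × EuclideanSpace ℝ (Fin 3) → EuclideanSpace ℝ (Fin 3),
      ContinuousOn W (closure (parabolicCylinder r ((X.T : ℝ), x₀))) ∧
        ∀ z ∈ parabolicCylinder r ((X.T : ℝ), x₀), uncurry X.u z = W z := by
  have hT := X.T_pos
  obtain ⟨r₀, hr₀, C, hC⟩ := hx₀
  -- ### a radius `ρ` with `ρ² ≤ T` (opaque), the base time `s = T − ρ²/2` (opaque)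
  obtain ⟨ρ, hρpos, hρr₀, hρT⟩ : ∃ ρ : ℝ, 0 < ρ ∧ ρ ≤ r₀ ∧ ρ ^ 2 ≤ X.T := by
    refine ⟨min r₀ (Real.sqrt X.T), lt_min hr₀ (Real.sqrt_pos.2 hT), min_le_left _ _, ?_⟩
    calc min r₀ (Real.sqrt X.T) ^ 2 ≤ Real.sqrt X.T ^ 2 :=
          pow_le_pow_left₀ (le_min hr₀.le (Real.sqrt_nonneg _)) (min_le_right _ _) 2
      _ = X.T := Real.sq_sqrt hT.le
  obtain ⟨s, hs⟩ : ∃ s : ℝ, s = X.T - ρ ^ 2 / 2 := ⟨_, rfl⟩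
  have hρ2 : 0 < ρ ^ 2 := by positivity
  have hs0 : 0 < s := by rw [hs]; linarith
  have hsT : s < X.T := by rw [hs]; linarith
  have hsr₀ : X.T - r₀ ^ 2 < s := by
    have : ρ ^ 2 ≤ r₀ ^ 2 := pow_le_pow_left₀ hρpos.le hρr₀ 2
    rw [hs]; linarith
  -- ### the projected force and the energy
  have hfs := X.force_isSmoothSpaceTimeOn_Icc
  have hfd := X.force_hasUniformRapidDecayOn_Icc
  obtain ⟨G, hG0, hG⟩ := exists_norm_clayProjForce_le hT hfs hfd
  have hgc := continuous_uncurry_clayProjForce hT hfs hfd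
  obtain ⟨G₂, hG₂, hg2⟩ := exists_eLpNorm_two_clayProjForce_le hT hfs hfd
  obtain ⟨Eu, hEut, hEu⟩ := X.energy_le hν
  -- ### the Duhamel term is continuous up to the top near `x₀`
  have hum : AEStronglyMeasurable (uncurry X.u)
      ((volume : Measure (ℝ × EuclideanSpace ℝ (Fin 3))).restrict (Ioo s X.T ×ˢ univ)) := by
    refine (X.classical.smooth_velocity.continuousOn.mono ?_).aestronglyMeasurable
      (measurableSet_Ioo.prod MeasurableSet.univ)
    exact Set.prod_mono (fun τ hτ => ⟨hs0.le.trans hτ.1.le, hτ.2⟩) subset_rfl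
  have hbd : ∀ t < X.T, ∃ N : ℝ, ∀ τ ∈ Ioo s t, ∀ y, ‖X.u τ y‖ ≤ N := by
    intro t ht
    obtain ⟨N, hN⟩ := X.exists_norm_le hν ht
    exact ⟨N, fun τ hτ y => hN τ ⟨hs0.le.trans hτ.1.le, hτ.2.le⟩ y⟩
  have hB : ∀ τ ∈ Ioo s X.T, ∀ y ∈ ball x₀ ρ, ‖X.u τ y‖ ≤ C := fun τ hτ y hy =>
    hC τ ⟨hsr₀.trans hτ.1, hτ.2⟩ y (ball_subset_ball hρr₀ hy)
  have hE : ∀ τ ∈ Ioo s X.T, ∫⁻ y, ‖X.u τ y‖ₑ ^ 2 ≤ Eu := fun τ hτ =>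
    hEu τ ⟨hs0.le.trans hτ.1.le, hτ.2⟩
  obtain ⟨Ψ, hΨc, hΨeq⟩ :=
    exists_continuousOn_oseenDuhamel_top hν hsT hum hbd hρpos hB hEut.ne hE
  -- ### the caloric term and the force term
  have hsI : s ∈ Ico 0 X.T := ⟨hs0.le, hsT⟩
  have hus_cont : Continuous (X.u s) := (X.classical.contDiff_velocity hsI).continuous
  obtain ⟨Ns, hNs⟩ := X.exists_norm_le hν hsT
  have hHc : ContinuousOn (fun q : ℝ × EuclideanSpace ℝ (Fin 3) =>
      UnboundedOperators.heatExtension (X.u s) (ν * (q.1 - s)) q.2)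
      {q : ℝ × EuclideanSpace ℝ (Fin 3) | s < q.1} := by
    have hsm := UnboundedOperators.contDiffOn_heatExtension_prod
      (UnboundedOperators.memLp_top_of_continuous_of_bound hus_cont
        (fun z => hNs s ⟨hs0.le, le_rfl⟩ z)) le_top
    have hmap : Continuous (fun q : ℝ × EuclideanSpace ℝ (Fin 3) => (ν * (q.1 - s), q.2)) :=
      (continuous_const.mul (continuous_fst.sub continuous_const)).prodMk continuous_snd
    have hmaps : MapsTo (fun q : ℝ × EuclideanSpace ℝ (Fin 3) => (ν * (q.1 - s), q.2))
        {q : ℝ × EuclideanSpace ℝ (Fin 3) | s < q.1} (Ioi (0 : ℝ) ×ˢ (univ : Set _)) :=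
      fun q hq => ⟨mul_pos hν (sub_pos.2 hq), mem_univ _⟩
    exact hsm.continuousOn.comp (f := fun q : ℝ × EuclideanSpace ℝ (Fin 3) => (ν * (q.1 - s), q.2))
      hmap.continuousOn hmaps
  have hFc : Continuous (uncurry (forceDuhamel ν s (clayProjForce hT hfs hfd))) :=
    continuous_uncurry_forceDuhamel hν hgc hG
  -- ### the representative and the cylinder `Q_{ρ/2}(T, x₀)`
  obtain ⟨W, hW⟩ : ∃ W : ℝ × EuclideanSpace ℝ (Fin 3) → EuclideanSpace ℝ (Fin 3), ∀ q,
      W q = UnboundedOperators.heatExtension (X.u s) (ν * (q.1 - s)) q.2 - Ψ q +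
        forceDuhamel ν s (clayProjForce hT hfs hfd) q.1 q.2 := ⟨fun q => _, fun q => rfl⟩
  obtain ⟨r, hr⟩ : ∃ r : ℝ, r = ρ / 2 := ⟨_, rfl⟩
  have hrpos : 0 < r := by rw [hr]; positivity
  have hrρ : r ≤ ρ := by rw [hr]; linarith
  have hrT : r ^ 2 ≤ X.T := (pow_le_pow_left₀ hrpos.le hrρ 2).trans hρT
  have hsr : s < X.T - r ^ 2 := by
    have : r ^ 2 = ρ ^ 2 / 4 := by rw [hr]; ring
    rw [hs, this]; linarith
  have hQV : parabolicCylinder r ((X.T : ℝ), x₀) ⊆ Ioo s X.T ×ˢ ball x₀ (ρ / 2) := by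
    intro q hq
    rw [mem_parabolicCylinder] at hq
    rw [← hr]
    exact ⟨⟨hsr.trans hq.1.1, hq.1.2⟩, hq.2⟩
  have hQH : closure (parabolicCylinder r ((X.T : ℝ), x₀)) ⊆
      {q : ℝ × EuclideanSpace ℝ (Fin 3) | s < q.1} := by
    have h1 : parabolicCylinder r ((X.T : ℝ), x₀) ⊆ Icc (X.T - r ^ 2) X.T ×ˢ univ := by
      intro q hq
      rw [mem_parabolicCylinder] at hq
      exact ⟨⟨hq.1.1.le, hq.1.2.le⟩, mem_univ _⟩
    refine ((closure_mono h1).trans ?_)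
    rw [(isClosed_Icc.prod isClosed_univ).closure_eq]
    rintro ⟨t, y⟩ ⟨ht, -⟩
    exact hsr.trans_le ht.1
  refine ⟨r, hrpos, hrT, W, ?_, ?_⟩
  · -- continuity on the closed cylinder
    have hc : ContinuousOn (fun q : ℝ × EuclideanSpace ℝ (Fin 3) =>
        UnboundedOperators.heatExtension (X.u s) (ν * (q.1 - s)) q.2 - Ψ q +
          forceDuhamel ν s (clayProjForce hT hfs hfd) q.1 q.2)
        (closure (parabolicCylinder r ((X.T : ℝ), x₀))) :=
      ((hHc.mono hQH).sub (hΨc.mono (closure_mono hQV))).add hFc.continuousOn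
    exact hc.congr fun q _ => hW q
  · -- `u = W` on the open cylinder: the forced Oseen identity from the base time `s`
    rintro ⟨t, x⟩ hq
    obtain ⟨⟨hst, htT⟩, hx⟩ := hQV hq
    -- the classical solution on `[0, t']`, `t' = (t + T)/2`, driven by the projected force
    obtain ⟨t', htt', ht'T⟩ : ∃ t' : ℝ, t < t' ∧ t' < X.T := ⟨(t + X.T) / 2, by linarith, by linarith⟩
    have ht'0 : 0 < t' := (hs0.trans hst).trans htt'
    obtain ⟨q, hcl⟩ : ∃ q : ℝ → EuclideanSpace ℝ (Fin 3) → ℝ,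
        IsClassicalNSSolutionOn (Icc 0 t') ν (clayProjForce hT hfs hfd) X.u q :=
      ⟨_, (X.classical_Icc ht'0 ht'T).to_clayProjForce_of_le hT hfs hfd ht'T.le⟩
    obtain ⟨B₁, hB₁⟩ := X.exists_norm_le hν ht'T
    have hM : 0 < max B₁ 1 := lt_of_lt_of_le one_pos (le_max_right _ _)
    have hbdM : ∀ τ ∈ Icc 0 t', ∀ y, ‖X.u τ y‖ ≤ max B₁ 1 := fun τ hτ y =>
      (hB₁ τ hτ y).trans (le_max_left _ _)
    have hid := hcl.eq_forced_oseenMild_of_bounded hν hgc hG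
      (fun τ _ => isWeaklyDivFree_clayProjForce hT hfs hfd τ) hG₂ (fun τ _ => hg2 τ)
      (X.energy t' ht'T) hM hbdM hs0.le hst htt'.le x
    have hΨ : Ψ (t, x) = oseenDuhamel ν s X.u X.u t x := hΨeq (t, x) ⟨⟨hst, htT⟩, hx⟩
    rw [uncurry_apply_pair, hW, hΨ]
    exact hid

/-! ## §2 The profile WITH the force -/

/-- **THE BLOW-UP PROFILE OF A CLAY BLOW-UP WITH ITS CLAY FORCE** (`ν > 0`; no named fact, no new
definition): there is `U : ℝ³ → ℝ³`, continuous on the regular set `{x | IsBackwardBoundedAt u T x}`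
(the complement of the compact `ℋ¹`-null singular slice), such that for every regular `x`,
`u(t, y) → U(x)` as `(t, y) → (T, x)` with `t < T`. (Off the regular set the values of `U` are junk.)
Same proof as g8's `exists_blowupProfile`, fed with `exists_continuousOn_closure_cylinder_forced`.
[cite: Leray1934, §32] [cite: LemarieRieusset2016, Thm. 6.1 (6.12)] -/
theorem exists_blowupProfile_forced (hν : 0 < ν) :
    ∃ U : EuclideanSpace ℝ (Fin 3) → EuclideanSpace ℝ (Fin 3),
      ContinuousOn U {x | IsBackwardBoundedAt X.u X.T x} ∧
        ∀ x : EuclideanSpace ℝ (Fin 3), IsBackwardBoundedAt X.u X.T x →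
          Tendsto (uncurry X.u) (𝓝[Iio X.T ×ˢ (univ : Set (EuclideanSpace ℝ (Fin 3)))] ((X.T : ℝ), x))
            (𝓝 (U x)) := by
  classical
  -- the limit at each regular point (any representative gives the same value)
  have hlim : ∀ x : EuclideanSpace ℝ (Fin 3), IsBackwardBoundedAt X.u X.T x →
      ∃ v : EuclideanSpace ℝ (Fin 3),
        Tendsto (uncurry X.u) (𝓝[Iio X.T ×ˢ (univ : Set (EuclideanSpace ℝ (Fin 3)))] ((X.T : ℝ), x))
          (𝓝 v) := by
    intro x hx
    obtain ⟨r, hr, -, W, hWc, hWu⟩ := X.exists_continuousOn_closure_cylinder_forced hν hx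
    exact ⟨W ((X.T : ℝ), x), X.tendsto_top_of_mem_ball hr hWc hWu (mem_ball_self hr)⟩
  set U : EuclideanSpace ℝ (Fin 3) → EuclideanSpace ℝ (Fin 3) := fun x =>
    if hx : IsBackwardBoundedAt X.u X.T x then (hlim x hx).choose else 0 with hU
  have hUlim : ∀ x : EuclideanSpace ℝ (Fin 3), IsBackwardBoundedAt X.u X.T x →
      Tendsto (uncurry X.u) (𝓝[Iio X.T ×ˢ (univ : Set (EuclideanSpace ℝ (Fin 3)))] ((X.T : ℝ), x))
        (𝓝 (U x)) := by
    intro x hx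
    have e : U x = (hlim x hx).choose := by simp only [hU, dif_pos hx]
    rw [e]
    exact (hlim x hx).choose_spec
  -- the filters are nontrivial: `(T, x)` is in the closure of the lower half-space
  have hbot : ∀ x : EuclideanSpace ℝ (Fin 3),
      (𝓝[Iio X.T ×ˢ (univ : Set (EuclideanSpace ℝ (Fin 3)))] ((X.T : ℝ), x)).NeBot := by
    intro x
    rw [← mem_closure_iff_nhdsWithin_neBot, closure_prod_eq, closure_Iio, closure_univ]
    exact ⟨self_mem_Iic, mem_univ _⟩
  refine ⟨U, ?_, hUlim⟩
  -- continuity on the regular set: near `x₀`, `U = W(T, ·)` for ONE representative `W`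
  intro x₀ hx₀
  obtain ⟨r, hr, -, W, hWc, hWu⟩ := X.exists_continuousOn_closure_cylinder_forced hν hx₀
  have hreg : ∀ x ∈ ball x₀ r, IsBackwardBoundedAt X.u X.T x := by
    intro x hx
    obtain ⟨M, hM⟩ := ((isCompact_Icc.prod (isCompact_closedBall x₀ r)).of_isClosed_subset
      isClosed_closure (closure_parabolicCylinder_subset r ((X.T : ℝ), x₀))).exists_bound_of_continuousOn hWc
    set r' : ℝ := r - dist x x₀ with hr'
    have hr'0 : 0 < r' := sub_pos.2 (mem_ball.1 hx)
    refine ⟨r', hr'0, M, fun t ht y hy => ?_⟩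
    have hz : ((t, y) : ℝ × EuclideanSpace ℝ (Fin 3)) ∈ parabolicCylinder r ((X.T : ℝ), x₀) := by
      rw [mem_parabolicCylinder]
      have h1 : r' ≤ r := by rw [hr']; linarith [dist_nonneg (x := x) (y := x₀)]
      have h2 : r' ^ 2 ≤ r ^ 2 := pow_le_pow_left₀ hr'0.le h1 2
      refine ⟨⟨by simp only; linarith [ht.1], ht.2⟩, ?_⟩
      calc dist y x₀ ≤ dist y x + dist x x₀ := dist_triangle _ _ _
        _ < r' + dist x x₀ := by linarith [mem_ball.1 hy]
        _ = r := by rw [hr']; ring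
    have := hM (t, y) (subset_closure hz)
    rw [← hWu (t, y) hz] at this
    exact this
  have hUeq : ∀ x ∈ ball x₀ r, U x = W ((X.T : ℝ), x) := fun x hx =>
    tendsto_nhds_unique' (hbot x) (hUlim x (hreg x hx)) (X.tendsto_top_of_mem_ball hr hWc hWu hx)
  -- `x ↦ W(T, x)` is continuous at `x₀`
  have hWT : ContinuousWithinAt (fun x => W ((X.T : ℝ), x)) (ball x₀ r) x₀ := by
    have hmaps : MapsTo (fun x : EuclideanSpace ℝ (Fin 3) => (((X.T : ℝ), x) : ℝ × EuclideanSpace ℝ (Fin 3)))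
        (ball x₀ r) (closure (parabolicCylinder r ((X.T : ℝ), x₀))) := fun x hx =>
      mem_closure_parabolicCylinder_top (T := X.T) hr (ball_subset_closedBall hx)
    exact (hWc _ (hmaps (mem_ball_self hr))).comp
      (Continuous.prodMk_right (X.T : ℝ)).continuousWithinAt hmaps
  have hcont : ContinuousWithinAt U (ball x₀ r) x₀ :=
    hWT.congr (fun x hx => hUeq x hx) (hUeq x₀ (mem_ball_self hr))
  exact (hcont.continuousAt (isOpen_ball.mem_nhds (mem_ball_self hr))).continuousWithinAt

/-- **Pointwise form WITH the force: `u(t, x) → U(x)` as `t ↑ T` at every regular point `x`**, with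
`U` the blow-up profile of `exists_blowupProfile_forced`. [cite: Leray1934, §32] -/
theorem tendsto_slice_blowupProfile_forced (hν : 0 < ν) :
    ∃ U : EuclideanSpace ℝ (Fin 3) → EuclideanSpace ℝ (Fin 3),
      ContinuousOn U {x | IsBackwardBoundedAt X.u X.T x} ∧
        ∀ x : EuclideanSpace ℝ (Fin 3), IsBackwardBoundedAt X.u X.T x →
          Tendsto (fun t => X.u t x) (𝓝[<] X.T) (𝓝 (U x)) := by
  obtain ⟨U, hUc, hU⟩ := X.exists_blowupProfile_forced hν
  refine ⟨U, hUc, fun x hx => ?_⟩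
  have hpath : Tendsto (fun t : ℝ => ((t, x) : ℝ × EuclideanSpace ℝ (Fin 3))) (𝓝[<] X.T)
      (𝓝[Iio X.T ×ˢ (univ : Set (EuclideanSpace ℝ (Fin 3)))] ((X.T : ℝ), x)) := by
    refine tendsto_nhdsWithin_of_tendsto_nhds_of_eventually_within _
      ((Continuous.prodMk_left x).tendsto X.T |>.mono_left nhdsWithin_le_nhds) ?_
    exact eventually_mem_nhdsWithin.mono fun t ht => ⟨ht, mem_univ _⟩
  exact (hU x hx).comp hpath

/-! ## §3 The profile has finite energy, WITH the force -/

/-- **THE BLOW-UP PROFILE OF A CLAY BLOW-UP WITH FORCE HAS FINITE ENERGY** (`ν > 0`; no named fact):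
there is `U : ℝ³ → ℝ³`, continuous on the regular set, with `u(t, x) → U(x)` as `t ↑ T` at every
regular `x`, hence for a.e. `x` (the singular slice is Lebesgue-null, `volume_singularSlice_eq_zero`,
force-free), and `∫⁻ ‖U‖ₑ² ≤ E` for the energy bound `E < ∞` of the type on `[0, T)` (Fatou along
`t ↑ T`). Same proof as g8's `exists_blowupProfile_finiteEnergy`. [cite: Leray1934, §32]
[cite: FeffermanClay2006, (C) (7)] -/
theorem exists_blowupProfile_finiteEnergy_forced (hν : 0 < ν) :
    ∃ U : EuclideanSpace ℝ (Fin 3) → EuclideanSpace ℝ (Fin 3),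
      ContinuousOn U {x | IsBackwardBoundedAt X.u X.T x} ∧
      (∀ x : EuclideanSpace ℝ (Fin 3), IsBackwardBoundedAt X.u X.T x →
        Tendsto (fun t => X.u t x) (𝓝[<] X.T) (𝓝 (U x))) ∧
      (∀ᵐ x : EuclideanSpace ℝ (Fin 3), Tendsto (fun t => X.u t x) (𝓝[<] X.T) (𝓝 (U x))) ∧
      ∃ E : ℝ≥0∞, E < ⊤ ∧ (∀ t ∈ Ico 0 X.T, ∫⁻ x, ‖X.u t x‖ₑ ^ 2 ≤ E) ∧
        ∫⁻ x, ‖U x‖ₑ ^ 2 ≤ E := by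
  have hT := X.T_pos
  obtain ⟨U, hUc, hU⟩ := X.tendsto_slice_blowupProfile_forced hν
  obtain ⟨E, hEt, hE⟩ := X.energy_le hν
  -- a.e. convergence: the singular slice is Lebesgue-null
  have hae : ∀ᵐ x : EuclideanSpace ℝ (Fin 3), Tendsto (fun t => X.u t x) (𝓝[<] X.T) (𝓝 (U x)) := by
    have hnull := X.volume_singularSlice_eq_zero hν
    rw [ae_iff]
    refine measure_mono_null (fun x hx => ?_) hnull
    simp only [mem_setOf_eq] at hx ⊢
    exact fun hreg => hx (hU x hreg)
  refine ⟨U, hUc, hU, hae, E, hEt, hE, ?_⟩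
  -- Fatou along `t ↑ T`, with the slices outside `[0, T)` replaced by `0` (measurability)
  classical
  set g : ℝ → EuclideanSpace ℝ (Fin 3) → ℝ≥0∞ := fun t x =>
    if t ∈ Ico 0 X.T then ‖X.u t x‖ₑ ^ 2 else 0 with hg
  have hg_meas : ∀ t, AEMeasurable (g t) volume := by
    intro t
    by_cases ht : t ∈ Ico 0 X.T
    · have hcont : Continuous (X.u t) := (X.classical.contDiff_velocity ht).continuous
      have : g t = fun x => ‖X.u t x‖ₑ ^ 2 := by
        funext x; simp only [hg, if_pos ht]
      rw [this]
      exact ((ENNReal.continuous_pow 2).comp hcont.enorm).aemeasurable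
    · have : g t = fun _ => 0 := by
        funext x; simp only [hg, if_neg ht]
      rw [this]
      exact aemeasurable_const
  have hev : ∀ᶠ t in 𝓝[<] X.T, t ∈ Ico 0 X.T := Ico_mem_nhdsLT hT
  -- the liminf of the slices is `‖U x‖²` a.e.
  have hlim : ∀ᵐ x : EuclideanSpace ℝ (Fin 3),
      liminf (fun t => g t x) (𝓝[<] X.T) = ‖U x‖ₑ ^ 2 := by
    filter_upwards [hae] with x hx
    have h1 : Tendsto (fun t => ‖X.u t x‖ₑ ^ 2) (𝓝[<] X.T) (𝓝 (‖U x‖ₑ ^ 2)) :=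
      ENNReal.Tendsto.pow hx.enorm
    have h2 : (fun t => g t x) =ᶠ[𝓝[<] X.T] fun t => ‖X.u t x‖ₑ ^ 2 := by
      filter_upwards [hev] with t ht
      simp only [hg, if_pos ht]
    rw [liminf_congr h2]
    exact h1.liminf_eq
  calc ∫⁻ x, ‖U x‖ₑ ^ 2 = ∫⁻ x, liminf (fun t => g t x) (𝓝[<] X.T) :=
        lintegral_congr_ae (hlim.mono fun x hx => hx.symm)
    _ ≤ liminf (fun t => ∫⁻ x, g t x) (𝓝[<] X.T) := lintegral_liminf_le' hg_meas
    _ ≤ E := by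
        refine liminf_le_of_frequently_le' (Eventually.frequently ?_)
        filter_upwards [hev] with t ht
        have : (fun x => g t x) = fun x => ‖X.u t x‖ₑ ^ 2 := by
          funext x; simp only [hg, if_pos ht]
        rw [this]
        exact hE t ht

end ClayBlowup

/-! ## §4 Twins and the (C)-reading -/

namespace DesignedBlowup

variable {ν : ℝ} (D : DesignedBlowup ν)

/-- **Designed blow-ups, WITH their force: continuous up to `T` at every backward bounded point.**
[cite: LemarieRieusset2016, Thm. 6.1 (6.12)] -/
theorem exists_continuousOn_closure_cylinder_forced (hν : 0 < ν)
    {x₀ : EuclideanSpace ℝ (Fin 3)} (hx₀ : IsBackwardBoundedAt D.u D.T x₀) :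
    ∃ r : ℝ, 0 < r ∧ r ^ 2 ≤ D.T ∧ ∃ W : ℝ × EuclideanSpace ℝ (Fin 3) → EuclideanSpace ℝ (Fin 3),
      ContinuousOn W (closure (parabolicCylinder r ((D.T : ℝ), x₀))) ∧
        ∀ z ∈ parabolicCylinder r ((D.T : ℝ), x₀), uncurry D.u z = W z :=
  D.toClayBlowup.exists_continuousOn_closure_cylinder_forced hν hx₀

/-- **Designed blow-ups, WITH their force: the finite-energy blow-up profile off `S_T`.**
[cite: Leray1934, §32] -/
theorem exists_blowupProfile_finiteEnergy_forced (hν : 0 < ν) :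
    ∃ U : EuclideanSpace ℝ (Fin 3) → EuclideanSpace ℝ (Fin 3),
      ContinuousOn U {x | IsBackwardBoundedAt D.u D.T x} ∧
      (∀ x : EuclideanSpace ℝ (Fin 3), IsBackwardBoundedAt D.u D.T x →
        Tendsto (fun t => D.u t x) (𝓝[<] D.T) (𝓝 (U x))) ∧
      (∀ᵐ x : EuclideanSpace ℝ (Fin 3), Tendsto (fun t => D.u t x) (𝓝[<] D.T) (𝓝 (U x))) ∧
      ∃ E : ℝ≥0∞, E < ⊤ ∧ (∀ t ∈ Ico 0 D.T, ∫⁻ x, ‖D.u t x‖ₑ ^ 2 ≤ E) ∧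
        ∫⁻ x, ‖U x‖ₑ ^ 2 ≤ E :=
  D.toClayBlowup.exists_blowupProfile_finiteEnergy_forced hν

end DesignedBlowup

/-- **(C)-READING**: if Fefferman's (C) holds — `NavierStokesBreakdownR3` — then at every viscosity
`ν > 0` there is a Clay blow-up WITH a Clay force whose velocity converges, as `t ↑ T`, to a
finite-energy profile continuous off its singular slice, locally uniformly at every regular point
(a necessary STRUCTURE of any (C)-certificate by blow-up; `ClayBlowup.ofBreakdown`). Nothing is
asserted about (C). [cite: FeffermanClay2006, (C)] [cite: Leray1934, §32] -/
theorem navierStokesBreakdownR3_profile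
    (h : Summit.NavierStokesRegularity.NavierStokesRegularity.NavierStokesBreakdownR3) {ν : ℝ}
    (hν : 0 < ν) :
    ∃ X : ClayBlowup ν, ∃ U : EuclideanSpace ℝ (Fin 3) → EuclideanSpace ℝ (Fin 3),
      ContinuousOn U {x | IsBackwardBoundedAt X.u X.T x} ∧
      (∀ x : EuclideanSpace ℝ (Fin 3), IsBackwardBoundedAt X.u X.T x →
        Tendsto (fun t => X.u t x) (𝓝[<] X.T) (𝓝 (U x))) ∧
      ∃ E : ℝ≥0∞, E < ⊤ ∧ ∫⁻ x, ‖U x‖ₑ ^ 2 ≤ E := by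
  obtain ⟨X⟩ := forall_nonempty_clayBlowup_of_breakdownR3 h ν hν
  obtain ⟨U, hUc, hU, -, E, hEt, -, hUE⟩ := X.exists_blowupProfile_finiteEnergy_forced hν
  exact ⟨X, U, hUc, hU, E, hEt, hUE⟩

end Summit.NavierStokesRegularity.FluidComputer

end
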